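import Summits.CriticalPhenomena.PercolationContinuityZ3.Theorems.Transplant.PlanarSkeletonFrmFromDefs
import Summits.CriticalPhenomena.PercolationContinuityZ3.Theorems.Transplant.SkelFrmFromBParamsFaceFloorsTXA
import Summits.CriticalPhenomena.PercolationContinuityZ3.Theorems.Transplant.SkelFrmBParamsFaceFloorsTXA
import Summits.CriticalPhenomena.PercolationContinuityZ3.Theorems.Transplant.SkelNegBParamsFaceFloorsAXA
import Summits.CriticalPhenomena.PercolationContinuityZ3.Theorems.Transplant.SkelNegBParamsRootArith
import HarnessLib
import Summits.CriticalPhenomena.PercolationContinuityZ3.Theorems.Transplant.SkelFrmBParamsFaceFloorsAXA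
/-!
# U-WAVE PORT (RULING D-U, lead g21 2026-08-26; WAVE-U-MANIFEST v3.1 row «SkelFrmBParamsFaceFloorsAXA» ↦ «SkelFrmFromBParamsFaceFloorsAXA») of the tree module
# `Transplant/SkelFrmBParamsFaceFloorsAXA` onto the carrier `PlanarSkeletonFrmFrom` (frames only, cylinders connected from width `ℓ₀` on)

ORIGINAL TITLE: N2 (frames-only node `SamePDropOfSkeletonFrmFrom₁`, OPEN) params column over `PlanarSkeletonFrm` — (ζ″) ledger, shape (B′) of record ((R-14)):

builds on p205010 (kernel theorem, internal audit signed; external expert review pending) — nothing in this file uses p205010; NOTHING is claimed about the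
OPEN node U `SamePDropOfSkeletonFrmFrom₁` (nor U_s / the end state).  Lane `prim-bschramm`, seat `prim-bschramm-stmt` gen 26 (port pen, RULING M-11 family P-stmt; tool = p3-g26's port_u.py of record, registry-driven inputs); helper file
(`--supports stmt-CriticalPhenomena-4575 --as helper`).  PORT RULES r1–r4 of RULING D-U: declaration order and proof texts are those of the original,
byte-identical except (i) the carrier token `PlanarSkeletonFrm ↦ PlanarSkeletonFrmFrom` (binders, `namespace`/`end` lines, qualified names of twinned
declarations), (ii) carrier-FREE declarations of the original (φ-level `Skelφ…` blocks and namespace-only arithmetic residents) are NOT re-declared —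
this file imports the original and `export`s the twin-free residents (POLICY T / treatment (m1)); residents whose statement mentions a twinned
constant are copied, (iii) every carrier-binding declaration keeps its explicit binder `(Φ : PlanarSkeletonFrmFrom G)` in its own signature (r2).  Docstrings and citations are the original's.
-/

noncomputable section

open scoped Classical

namespace Summit.CriticalPhenomena.PercolationContinuityZ3.Theorems.Transplant

namespace PlanarSkeletonFrmFrom

namespace NegB

open Literature.Probability.Percolation Literature.Probability.LatticeModels SimpleGraph
open SkelConc (Consts)
open Skelφ (shearUnit xBoxB xBoxLoA xBoxHiA)
open Skelφ.StepI (DataN)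
open TwoAxis.Para (modulus)
open Neg

namespace KS

section FloorsAX

/-- The origin's along reading lies within `3u₀` of `0` when `|Λ₀(yL)| ≤ 3m`. [folklore] -/
theorem FcA_abs_le (κ : Consts) {V : Type} [DecidableEq V] [Countable V] {G : SimpleGraph V} [G.LocallyFinite] (Φ : PlanarSkeletonFrmFrom G) (t : V) (p : unitInterval) (D : Skelφ.StepI.DataNS V) (g : ℕ) (f : ℕ) (hN : EqNumL κ Φ t p D g f) (yL : Site 2)
    (hΛ₀ : |Λ₀of κ Φ t p D g f yL| ≤ 3 * modulus (nL κ Φ t p D g f) (hL κ Φ t p D g f) (vL κ Φ t p D g f) (vβL κ Φ t p D g f)) :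
    -(3 * u₀A κ Φ t p D g f) ≤ FcA κ Φ t p D g f yL ∧ FcA κ Φ t p D g f yL ≤ 3 * u₀A κ Φ t p D g f := by
  obtain ⟨hn1, hℓ1⟩ := one_le_of_eqNumL κ Φ t p D g f hN
  have hm0 : 0 < modulus (nL κ Φ t p D g f) (hL κ Φ t p D g f) (vL κ Φ t p D g f) (vβL κ Φ t p D g f) := Skelφ.NegPrm.modulus_vβOf_pos hn1 hℓ1 _ _
  have hu : 1 ≤ u₀A κ Φ t p D g f := (units_eqA κ Φ t p D g f).2.2.2.2.1
  have hF := FcA_eq κ Φ t p D g f yL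
  obtain ⟨f1, f2⟩ := PlanarSkeletonNeg.NegB.RootArith.floor_sandwich (x := 2 * u₀A κ Φ t p D g f * Λ₀of κ Φ t p D g f yL + modulus (nL κ Φ t p D g f) (hL κ Φ t p D g f) (vL κ Φ t p D g f) (vβL κ Φ t p D g f))
    (d := 2 * modulus (nL κ Φ t p D g f) (hL κ Φ t p D g f) (vL κ Φ t p D g f) (vβL κ Φ t p D g f)) (by linarith)
  rw [← hF] at f1 f2
  set m := modulus (nL κ Φ t p D g f) (hL κ Φ t p D g f) (vL κ Φ t p D g f) (vβL κ Φ t p D g f)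
  set u := u₀A κ Φ t p D g f
  set F := FcA κ Φ t p D g f yL
  obtain ⟨hΛa, hΛb⟩ := abs_le.1 hΛ₀
  have huΛ1 : u * (-(3 * m)) ≤ u * Λ₀of κ Φ t p D g f yL := mul_le_mul_of_nonneg_left hΛa (by linarith)
  have huΛ2 : u * Λ₀of κ Φ t p D g f yL ≤ u * (3 * m) := mul_le_mul_of_nonneg_left hΛb (by linarith)
  constructor
  · by_contra hc; push Not at hc
    have h1 : 2 * m * F ≤ 2 * m * (-(3 * u) - 1) := mul_le_mul_of_nonneg_left (by linarith) (by linarith)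
    nlinarith
  · by_contra hc; push Not at hc
    have h1 : 2 * m * (3 * u + 1) ≤ 2 * m * F := mul_le_mul_of_nonneg_left (by linarith) (by linarith)
    nlinarith

export PlanarSkeletonNeg.NegB.KS (xBoxA_bounds)

/-- **`FX1` at the (ζ′) x-face tuple** (`σ = 1`; the near end of region `k` above `flo`). [cite: KozmaNitzan2024, §4 Lemma 12 (pp. 23–25)] -/
theorem FX1_XA (κ : Consts) {V : Type} [DecidableEq V] [Countable V] {G : SimpleGraph V} [G.LocallyFinite] (Φ : PlanarSkeletonFrmFrom G) (t : V) (p : unitInterval) (D : Skelφ.StepI.DataNS V) (g : ℕ) (f : ℕ) (mk : ℕ) (hN : EqNumL κ Φ t p D g f) (hκ : (hL κ Φ t p D g f).natAbs ≤ 10 * nL κ Φ t p D g f)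
    (hnA : 2000 * Neg.Kq κ * (RA' κ Φ t p D mk + 2) ≤ nL κ Φ t p D g f) (hℓ : 22000 * Neg.Kq κ * (RA' κ Φ t p D mk + 2) ≤ ℓL κ Φ t p D g f)
    (hs0 : 6 * (RA' κ Φ t p D mk : ℤ) + 11 ≤ u₀A κ Φ t p D g f) (yL : Site 2)
    (hΛ₀ : |Λ₀of κ Φ t p D g f yL| ≤ 3 * modulus (nL κ Φ t p D g f) (hL κ Φ t p D g f) (vL κ Φ t p D g f) (vβL κ Φ t p D g f))
    {qB : ℕ} (hq : 4 * qB ≤ nL κ Φ t p D g f) {lev E : ℤ} {j : ℕ} (hE : E ≤ 2 * (RA' κ Φ t p D mk : ℤ))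
    (hlev : 5 * ((fcellsA κ Φ t p D g f).r 0 : ℤ) + 10 * u₀A κ Φ t p D g f * ((j : ℤ) + 1) - 1 - E ≤ lev)
    {k : ℕ} (hk : k + 1 ≤ 1000 * Neg.Kq κ) :
    (nL κ Φ t p D g f : ℤ) * modulus (nL κ Φ t p D g f) (hL κ Φ t p D g f) (vL κ Φ t p D g f) (vβL κ Φ t p D g f) *
        ((5 * ((fcellsA κ Φ t p D g f).r 0 : ℤ) + 10 * u₀A κ Φ t p D g f * (j : ℤ) + 3 - lev) - FcA κ Φ t p D g f yL) ≤
      u₀A κ Φ t p D g f * modulus (nL κ Φ t p D g f) (hL κ Φ t p D g f) (vL κ Φ t p D g f) (vβL κ Φ t p D g f) * xBoxLoA (nL κ Φ t p D g f) qB (RA' κ Φ t p D mk) k -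
        u₀A κ Φ t p D g f * (nL κ Φ t p D g f : ℤ) * (shearUnit (nL κ Φ t p D g f) (hL κ Φ t p D g f) : ℤ) *
          (xBoxB (nL κ Φ t p D g f) (ℓL κ Φ t p D g f) (hL κ Φ t p D g f) (RA' κ Φ t p D mk) k + 1) -
        u₀A κ Φ t p D g f * (nL κ Φ t p D g f : ℤ) - (nL κ Φ t p D g f : ℤ) * modulus (nL κ Φ t p D g f) (hL κ Φ t p D g f) (vL κ Φ t p D g f) (vβL κ Φ t p D g f) := by
  obtain ⟨hn1, hℓ1⟩ := one_le_of_eqNumL κ Φ t p D g f hN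
  have hm0 : 0 < modulus (nL κ Φ t p D g f) (hL κ Φ t p D g f) (vL κ Φ t p D g f) (vβL κ Φ t p D g f) := Skelφ.NegPrm.modulus_vβOf_pos hn1 hℓ1 _ _
  have hu : 1 ≤ u₀A κ Φ t p D g f := (units_eqA κ Φ t p D g f).2.2.2.2.1
  have hn : (1 : ℤ) ≤ (nL κ Φ t p D g f : ℤ) := by exact_mod_cast hn1
  obtain ⟨hFlo, -⟩ := FcA_abs_le κ Φ t p D g f hN yL hΛ₀
  have hsl := slant_le κ Φ t p D g f mk hN hκ hℓ hk (mul_nonneg (by linarith : 0 ≤ u₀A κ Φ t p D g f) (by linarith : (0:ℤ) ≤ (nL κ Φ t p D g f : ℤ)))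
  have hnA' : 2000 * (Neg.Kq κ : ℤ) * ((RA' κ Φ t p D mk : ℤ) + 2) ≤ (nL κ Φ t p D g f : ℤ) := by exact_mod_cast hnA
  have hq' : 4 * (qB : ℤ) ≤ (nL κ Φ t p D g f : ℤ) := by exact_mod_cast hq
  have hKq : (1 : ℤ) ≤ (Neg.Kq κ : ℤ) := by exact_mod_cast Neg.one_le_Kq κ
  have hR0 : (0 : ℤ) ≤ (RA' κ Φ t p D mk : ℤ) := Nat.cast_nonneg _
  have hQR : (RA' κ Φ t p D mk : ℤ) ≤ (Neg.Kq κ : ℤ) * (RA' κ Φ t p D mk : ℤ) := le_mul_of_one_le_left hR0 hKq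
  have hRn : RA' κ Φ t p D mk ≤ nL κ Φ t p D g f := by
    have : RA' κ Φ t p D mk ≤ 2000 * Neg.Kq κ * (RA' κ Φ t p D mk + 2) := by
      have := Neg.one_le_Kq κ; nlinarith
    omega
  obtain ⟨hLo, -⟩ := xBoxA_bounds (qB := qB) hRn k
  have hm2000 : (2000 : ℤ) ≤ modulus (nL κ Φ t p D g f) (hL κ Φ t p D g f) (vL κ Φ t p D g f) (vβL κ Φ t p D g f) := by
    have hm := (Skelφ.NegPrm.modulus_vβOf hn1 (hL κ Φ t p D g f) (ℓL κ Φ t p D g f) (vL κ Φ t p D g f)).1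
    have e : vβL κ Φ t p D g f = Skelφ.NegPrm.vβOf (nL κ Φ t p D g f) (hL κ Φ t p D g f) (ℓL κ Φ t p D g f) (vL κ Φ t p D g f) := rfl
    rw [← e] at hm
    have hℓ' : 22000 * (Neg.Kq κ : ℤ) * ((RA' κ Φ t p D mk : ℤ) + 2) ≤ (ℓL κ Φ t p D g f : ℤ) := by exact_mod_cast hℓ
    have hKR : (0 : ℤ) ≤ (Neg.Kq κ : ℤ) * (RA' κ Φ t p D mk : ℤ) := mul_nonneg (by linarith) hR0
    have h1 : (1 : ℤ) * ((ℓL κ Φ t p D g f : ℤ) - 1) ≤ (nL κ Φ t p D g f : ℤ) * ((ℓL κ Φ t p D g f : ℤ) - 1) :=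
      mul_le_mul_of_nonneg_right hn (by linarith)
    linarith
  clear hnA hq hk hℓ hκ hΛ₀
  set n : ℤ := (nL κ Φ t p D g f : ℤ)
  set m := modulus (nL κ Φ t p D g f) (hL κ Φ t p D g f) (vL κ Φ t p D g f) (vβL κ Φ t p D g f)
  set u := u₀A κ Φ t p D g f
  set F := FcA κ Φ t p D g f yL
  set R : ℤ := (RA' κ Φ t p D mk : ℤ)
  set Q : ℤ := (Neg.Kq κ : ℤ)
  set L := xBoxLoA (nL κ Φ t p D g f) qB (RA' κ Φ t p D mk) k
  set S := (shearUnit (nL κ Φ t p D g f) (hL κ Φ t p D g f) : ℤ) * (xBoxB (nL κ Φ t p D g f) (ℓL κ Φ t p D g f) (hL κ Φ t p D g f) (RA' κ Φ t p D mk) k + 1)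
  set r : ℤ := ((fcellsA κ Φ t p D g f).r 0 : ℤ)
  have hnm : 0 < n * m := mul_pos (by linarith) hm0
  have hum : 0 ≤ u * m := mul_nonneg (by linarith) hm0.le
  -- products
  have p1 : n * m * ((5 * r + 10 * u * (j : ℤ) + 3 - lev) - F) ≤ n * m * (4 - 10 * u + E + 3 * u) := by
    refine mul_le_mul_of_nonneg_left ?_ hnm.le
    have : 10 * u * ((j : ℤ) + 1) = 10 * u * (j : ℤ) + 10 * u := by ring
    linarith
  have p2 : u * m * (-((qB : ℤ) + R + n)) ≤ u * m * L := mul_le_mul_of_nonneg_left hLo hum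
  have p3 : n * m * E ≤ n * m * (2 * R) := mul_le_mul_of_nonneg_left hE hnm.le
  have p4 : n * m * (6 * R + 11) ≤ n * m * u := mul_le_mul_of_nonneg_left hs0 hnm.le
  have p5 : u * m * (4 * (qB : ℤ)) ≤ u * m * n := mul_le_mul_of_nonneg_left hq' hum
  have p6 : u * m * (2000 * R) ≤ u * m * n := mul_le_mul_of_nonneg_left (by nlinarith) hum
  have p7 : u * n * 2000 ≤ u * n * m := mul_le_mul_of_nonneg_left hm2000 (mul_nonneg (by linarith) (by linarith))
  nlinarith [p1, p2, p3, p4, p5, p6, p7, hsl, hnm, hum]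

/-- **`FX3` at the (ζ′) x-face tuple** (`σ = −1`; mirror of `FX1`). [cite: KozmaNitzan2024, §4 Lemma 12 (pp. 23–25)] -/
theorem FX3_XA (κ : Consts) {V : Type} [DecidableEq V] [Countable V] {G : SimpleGraph V} [G.LocallyFinite] (Φ : PlanarSkeletonFrmFrom G) (t : V) (p : unitInterval) (D : Skelφ.StepI.DataNS V) (g : ℕ) (f : ℕ) (mk : ℕ) (hN : EqNumL κ Φ t p D g f) (hκ : (hL κ Φ t p D g f).natAbs ≤ 10 * nL κ Φ t p D g f)
    (hnA : 2000 * Neg.Kq κ * (RA' κ Φ t p D mk + 2) ≤ nL κ Φ t p D g f) (hℓ : 22000 * Neg.Kq κ * (RA' κ Φ t p D mk + 2) ≤ ℓL κ Φ t p D g f)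
    (hs0 : 6 * (RA' κ Φ t p D mk : ℤ) + 11 ≤ u₀A κ Φ t p D g f) (yL : Site 2)
    (hΛ₀ : |Λ₀of κ Φ t p D g f yL| ≤ 3 * modulus (nL κ Φ t p D g f) (hL κ Φ t p D g f) (vL κ Φ t p D g f) (vβL κ Φ t p D g f))
    {qB : ℕ} (hq : 4 * qB ≤ nL κ Φ t p D g f) {lev E : ℤ} {j : ℕ} (hE : E ≤ 2 * (RA' κ Φ t p D mk : ℤ))
    (hlev : 5 * ((fcellsA κ Φ t p D g f).r 0 : ℤ) + 10 * u₀A κ Φ t p D g f * ((j : ℤ) + 1) - 1 - E ≤ lev)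
    {k : ℕ} (hk : k + 1 ≤ 1000 * Neg.Kq κ) :
    (nL κ Φ t p D g f : ℤ) * modulus (nL κ Φ t p D g f) (hL κ Φ t p D g f) (vL κ Φ t p D g f) (vβL κ Φ t p D g f) *
        ((5 * ((fcellsA κ Φ t p D g f).r 0 : ℤ) + 10 * u₀A κ Φ t p D g f * (j : ℤ) + 3 - lev) + FcA κ Φ t p D g f yL + 1) ≤
      u₀A κ Φ t p D g f * modulus (nL κ Φ t p D g f) (hL κ Φ t p D g f) (vL κ Φ t p D g f) (vβL κ Φ t p D g f) * xBoxLoA (nL κ Φ t p D g f) qB (RA' κ Φ t p D mk) k -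
        u₀A κ Φ t p D g f * (nL κ Φ t p D g f : ℤ) * (shearUnit (nL κ Φ t p D g f) (hL κ Φ t p D g f) : ℤ) *
          (xBoxB (nL κ Φ t p D g f) (ℓL κ Φ t p D g f) (hL κ Φ t p D g f) (RA' κ Φ t p D mk) k + 1) := by
  obtain ⟨hn1, hℓ1⟩ := one_le_of_eqNumL κ Φ t p D g f hN
  have hm0 : 0 < modulus (nL κ Φ t p D g f) (hL κ Φ t p D g f) (vL κ Φ t p D g f) (vβL κ Φ t p D g f) := Skelφ.NegPrm.modulus_vβOf_pos hn1 hℓ1 _ _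
  have hu : 1 ≤ u₀A κ Φ t p D g f := (units_eqA κ Φ t p D g f).2.2.2.2.1
  have hn : (1 : ℤ) ≤ (nL κ Φ t p D g f : ℤ) := by exact_mod_cast hn1
  obtain ⟨-, hFhi⟩ := FcA_abs_le κ Φ t p D g f hN yL hΛ₀
  have hsl := slant_le κ Φ t p D g f mk hN hκ hℓ hk (mul_nonneg (by linarith : 0 ≤ u₀A κ Φ t p D g f) (by linarith : (0:ℤ) ≤ (nL κ Φ t p D g f : ℤ)))
  have hnA' : 2000 * (Neg.Kq κ : ℤ) * ((RA' κ Φ t p D mk : ℤ) + 2) ≤ (nL κ Φ t p D g f : ℤ) := by exact_mod_cast hnA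
  have hq' : 4 * (qB : ℤ) ≤ (nL κ Φ t p D g f : ℤ) := by exact_mod_cast hq
  have hKq : (1 : ℤ) ≤ (Neg.Kq κ : ℤ) := by exact_mod_cast Neg.one_le_Kq κ
  have hR0 : (0 : ℤ) ≤ (RA' κ Φ t p D mk : ℤ) := Nat.cast_nonneg _
  have hQR : (RA' κ Φ t p D mk : ℤ) ≤ (Neg.Kq κ : ℤ) * (RA' κ Φ t p D mk : ℤ) := le_mul_of_one_le_left hR0 hKq
  have hRn : RA' κ Φ t p D mk ≤ nL κ Φ t p D g f := by
    have : RA' κ Φ t p D mk ≤ 2000 * Neg.Kq κ * (RA' κ Φ t p D mk + 2) := by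
      have := Neg.one_le_Kq κ; nlinarith
    omega
  obtain ⟨hLo, -⟩ := xBoxA_bounds (qB := qB) hRn k
  clear hnA hq hk hℓ hκ hΛ₀
  set n : ℤ := (nL κ Φ t p D g f : ℤ)
  set m := modulus (nL κ Φ t p D g f) (hL κ Φ t p D g f) (vL κ Φ t p D g f) (vβL κ Φ t p D g f)
  set u := u₀A κ Φ t p D g f
  set F := FcA κ Φ t p D g f yL
  set R : ℤ := (RA' κ Φ t p D mk : ℤ)
  set Q : ℤ := (Neg.Kq κ : ℤ)
  set L := xBoxLoA (nL κ Φ t p D g f) qB (RA' κ Φ t p D mk) k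
  set S := (shearUnit (nL κ Φ t p D g f) (hL κ Φ t p D g f) : ℤ) * (xBoxB (nL κ Φ t p D g f) (ℓL κ Φ t p D g f) (hL κ Φ t p D g f) (RA' κ Φ t p D mk) k + 1)
  set r : ℤ := ((fcellsA κ Φ t p D g f).r 0 : ℤ)
  have hnm : 0 < n * m := mul_pos (by linarith) hm0
  have hum : 0 ≤ u * m := mul_nonneg (by linarith) hm0.le
  have p1 : n * m * ((5 * r + 10 * u * (j : ℤ) + 3 - lev) + F + 1) ≤ n * m * (4 - 10 * u + E + 3 * u + 1) := by
    refine mul_le_mul_of_nonneg_left ?_ hnm.le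
    have : 10 * u * ((j : ℤ) + 1) = 10 * u * (j : ℤ) + 10 * u := by ring
    linarith
  have p2 : u * m * (-((qB : ℤ) + R + n)) ≤ u * m * L := mul_le_mul_of_nonneg_left hLo hum
  have p3 : n * m * E ≤ n * m * (2 * R) := mul_le_mul_of_nonneg_left hE hnm.le
  have p4 : n * m * (6 * R + 11) ≤ n * m * u := mul_le_mul_of_nonneg_left hs0 hnm.le
  have p5 : u * m * (4 * (qB : ℤ)) ≤ u * m * n := mul_le_mul_of_nonneg_left hq' hum
  have p6 : u * m * (2000 * R) ≤ u * m * n := mul_le_mul_of_nonneg_left (by nlinarith) hum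
  nlinarith [p1, p2, p3, p4, p5, p6, hsl, hnm, hum]

/-- **`FX2` at the (ζ′) x-face tuple** (`σ = 1`; the far end of region `k ≤ Nr` below `fhi`, given the count's far-end fact `hfar`).
[cite: KozmaNitzan2024, §4 Lemma 12 (pp. 23–25)] -/
theorem FX2_XA (κ : Consts) {V : Type} [DecidableEq V] [Countable V] {G : SimpleGraph V} [G.LocallyFinite] (Φ : PlanarSkeletonFrmFrom G) (t : V) (p : unitInterval) (D : Skelφ.StepI.DataNS V) (g : ℕ) (f : ℕ) (mk : ℕ) (hN : EqNumL κ Φ t p D g f) (hκ : (hL κ Φ t p D g f).natAbs ≤ 10 * nL κ Φ t p D g f)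
    (hnA : 2000 * Neg.Kq κ * (RA' κ Φ t p D mk + 2) ≤ nL κ Φ t p D g f) (hℓ : 22000 * Neg.Kq κ * (RA' κ Φ t p D mk + 2) ≤ ℓL κ Φ t p D g f)
    (yL : Site 2) {qB : ℕ} (hq : 4 * qB ≤ nL κ Φ t p D g f) {lev : ℤ} {Nr : ℕ} (hNr : Nr + 1 ≤ 1000 * Neg.Kq κ)
    (hfar : FcA κ Φ t p D g f yL + u₀A κ Φ t p D g f * ((Nr : ℤ) + 1) ≤ 20 * ((fcellsA κ Φ t p D g f).r 0 : ℤ) - lev + 2 * u₀A κ Φ t p D g f)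
    {k : ℕ} (hk : k ≤ Nr) :
    (nL κ Φ t p D g f : ℤ) * modulus (nL κ Φ t p D g f) (hL κ Φ t p D g f) (vL κ Φ t p D g f) (vβL κ Φ t p D g f) * (FcA κ Φ t p D g f yL + 1) +
        u₀A κ Φ t p D g f * modulus (nL κ Φ t p D g f) (hL κ Φ t p D g f) (vL κ Φ t p D g f) (vβL κ Φ t p D g f) * xBoxHiA (nL κ Φ t p D g f) qB (RA' κ Φ t p D mk) k +
        u₀A κ Φ t p D g f * (nL κ Φ t p D g f : ℤ) * (shearUnit (nL κ Φ t p D g f) (hL κ Φ t p D g f) : ℤ) *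
          (xBoxB (nL κ Φ t p D g f) (ℓL κ Φ t p D g f) (hL κ Φ t p D g f) (RA' κ Φ t p D mk) k + 1) ≤
      (nL κ Φ t p D g f : ℤ) * modulus (nL κ Φ t p D g f) (hL κ Φ t p D g f) (vL κ Φ t p D g f) (vβL κ Φ t p D g f) *
        (25 * ((fcellsA κ Φ t p D g f).r 0 : ℤ) - 2 - lev) := by
  obtain ⟨hn1, hℓ1⟩ := one_le_of_eqNumL κ Φ t p D g f hN
  have hm0 : 0 < modulus (nL κ Φ t p D g f) (hL κ Φ t p D g f) (vL κ Φ t p D g f) (vβL κ Φ t p D g f) := Skelφ.NegPrm.modulus_vβOf_pos hn1 hℓ1 _ _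
  have hu : 1 ≤ u₀A κ Φ t p D g f := (units_eqA κ Φ t p D g f).2.2.2.2.1
  have hr0 : ((fcellsA κ Φ t p D g f).r 0 : ℤ) = 40 * (Neg.Kq κ : ℤ) * u₀A κ Φ t p D g f := (units_eqA κ Φ t p D g f).2.2.1
  have hn : (1 : ℤ) ≤ (nL κ Φ t p D g f : ℤ) := by exact_mod_cast hn1
  have hk1 : k + 1 ≤ 1000 * Neg.Kq κ := by omega
  have hsl := slant_le κ Φ t p D g f mk hN hκ hℓ hk1 (mul_nonneg (by linarith : 0 ≤ u₀A κ Φ t p D g f) (by linarith : (0:ℤ) ≤ (nL κ Φ t p D g f : ℤ)))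
  have hnA' : 2000 * (Neg.Kq κ : ℤ) * ((RA' κ Φ t p D mk : ℤ) + 2) ≤ (nL κ Φ t p D g f : ℤ) := by exact_mod_cast hnA
  have hq' : 4 * (qB : ℤ) ≤ (nL κ Φ t p D g f : ℤ) := by exact_mod_cast hq
  have hKq : (1 : ℤ) ≤ (Neg.Kq κ : ℤ) := by exact_mod_cast Neg.one_le_Kq κ
  have hR0 : (0 : ℤ) ≤ (RA' κ Φ t p D mk : ℤ) := Nat.cast_nonneg _
  have hNr' : (Nr : ℤ) + 1 ≤ 1000 * (Neg.Kq κ : ℤ) := by exact_mod_cast hNr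
  have hk' : (k : ℤ) ≤ Nr := by exact_mod_cast hk
  have hRn : RA' κ Φ t p D mk ≤ nL κ Φ t p D g f := by
    have : RA' κ Φ t p D mk ≤ 2000 * Neg.Kq κ * (RA' κ Φ t p D mk + 2) := by
      have := Neg.one_le_Kq κ; nlinarith
    omega
  obtain ⟨-, hHi⟩ := xBoxA_bounds (qB := qB) hRn k
  clear hnA hq hk hk1 hℓ hκ hNr
  rw [hHi]
  rw [hr0] at hfar ⊢
  set n : ℤ := (nL κ Φ t p D g f : ℤ)
  set m := modulus (nL κ Φ t p D g f) (hL κ Φ t p D g f) (vL κ Φ t p D g f) (vβL κ Φ t p D g f)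
  set u := u₀A κ Φ t p D g f
  set F := FcA κ Φ t p D g f yL
  set R : ℤ := (RA' κ Φ t p D mk : ℤ)
  set Q : ℤ := (Neg.Kq κ : ℤ)
  set S := (shearUnit (nL κ Φ t p D g f) (hL κ Φ t p D g f) : ℤ) * (xBoxB (nL κ Φ t p D g f) (ℓL κ Φ t p D g f) (hL κ Φ t p D g f) (RA' κ Φ t p D mk) k + 1)
  have hnm : 0 < n * m := mul_pos (by linarith) hm0
  have hum : 0 ≤ u * m := mul_nonneg (by linarith) hm0.le
  -- `u·(k+1) ≤ u·(Nr+1)`, `(k+1)·R ≤ 1000QR ≤ n/2`, `qB ≤ n/4`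
  have hkR : ((k : ℤ) + 1) * R ≤ 1000 * Q * R := mul_le_mul_of_nonneg_right (by linarith) hR0
  have p1 : n * m * (F + u * ((k : ℤ) + 1)) ≤ n * m * (20 * (40 * Q * u) - lev + 2 * u) := by
    refine mul_le_mul_of_nonneg_left ?_ hnm.le
    have : u * ((k : ℤ) + 1) ≤ u * ((Nr : ℤ) + 1) := mul_le_mul_of_nonneg_left (by linarith) (by linarith)
    linarith
  have p2 : u * m * (((k : ℤ) + 1) * R) ≤ u * m * (1000 * Q * R) := mul_le_mul_of_nonneg_left hkR hum
  have p3 : u * m * (4 * (qB : ℤ)) ≤ u * m * n := mul_le_mul_of_nonneg_left hq' hum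
  have p4 : u * m * (2000 * Q * R) ≤ u * m * n := mul_le_mul_of_nonneg_left (by nlinarith) hum
  have p5 : n * m * (8 * u + 3) ≤ n * m * (5 * (40 * Q * u)) := by
    refine mul_le_mul_of_nonneg_left ?_ hnm.le
    nlinarith
  have e : u * m * (((k : ℤ) + 1) * (n + R) + (qB : ℤ)) = n * m * (u * ((k : ℤ) + 1)) + u * m * (((k : ℤ) + 1) * R) + u * m * (qB : ℤ) := by ring
  nlinarith [p1, p2, p3, p4, p5, hsl, hnm, hum, e]

/-- **`FX4` at the (ζ′) x-face tuple** (`σ = −1`; mirror of `FX2`). [cite: KozmaNitzan2024, §4 Lemma 12 (pp. 23–25)] -/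
theorem FX4_XA (κ : Consts) {V : Type} [DecidableEq V] [Countable V] {G : SimpleGraph V} [G.LocallyFinite] (Φ : PlanarSkeletonFrmFrom G) (t : V) (p : unitInterval) (D : Skelφ.StepI.DataNS V) (g : ℕ) (f : ℕ) (mk : ℕ) (hN : EqNumL κ Φ t p D g f) (hκ : (hL κ Φ t p D g f).natAbs ≤ 10 * nL κ Φ t p D g f)
    (hnA : 2000 * Neg.Kq κ * (RA' κ Φ t p D mk + 2) ≤ nL κ Φ t p D g f) (hℓ : 22000 * Neg.Kq κ * (RA' κ Φ t p D mk + 2) ≤ ℓL κ Φ t p D g f)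
    (yL : Site 2) {qB : ℕ} (hq : 4 * qB ≤ nL κ Φ t p D g f) {lev : ℤ} {Nr : ℕ} (hNr : Nr + 1 ≤ 1000 * Neg.Kq κ)
    (hfar : -FcA κ Φ t p D g f yL + u₀A κ Φ t p D g f * ((Nr : ℤ) + 1) ≤ 20 * ((fcellsA κ Φ t p D g f).r 0 : ℤ) - lev + 2 * u₀A κ Φ t p D g f)
    {k : ℕ} (hk : k ≤ Nr) :
    -((nL κ Φ t p D g f : ℤ) * modulus (nL κ Φ t p D g f) (hL κ Φ t p D g f) (vL κ Φ t p D g f) (vβL κ Φ t p D g f) * FcA κ Φ t p D g f yL) +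
        u₀A κ Φ t p D g f * modulus (nL κ Φ t p D g f) (hL κ Φ t p D g f) (vL κ Φ t p D g f) (vβL κ Φ t p D g f) * xBoxHiA (nL κ Φ t p D g f) qB (RA' κ Φ t p D mk) k +
        u₀A κ Φ t p D g f * (nL κ Φ t p D g f : ℤ) * (shearUnit (nL κ Φ t p D g f) (hL κ Φ t p D g f) : ℤ) *
          (xBoxB (nL κ Φ t p D g f) (ℓL κ Φ t p D g f) (hL κ Φ t p D g f) (RA' κ Φ t p D mk) k + 1) +
        u₀A κ Φ t p D g f * (nL κ Φ t p D g f : ℤ) + (nL κ Φ t p D g f : ℤ) * modulus (nL κ Φ t p D g f) (hL κ Φ t p D g f) (vL κ Φ t p D g f) (vβL κ Φ t p D g f) ≤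
      (nL κ Φ t p D g f : ℤ) * modulus (nL κ Φ t p D g f) (hL κ Φ t p D g f) (vL κ Φ t p D g f) (vβL κ Φ t p D g f) *
        (25 * ((fcellsA κ Φ t p D g f).r 0 : ℤ) - 2 - lev) := by
  obtain ⟨hn1, hℓ1⟩ := one_le_of_eqNumL κ Φ t p D g f hN
  have hm0 : 0 < modulus (nL κ Φ t p D g f) (hL κ Φ t p D g f) (vL κ Φ t p D g f) (vβL κ Φ t p D g f) := Skelφ.NegPrm.modulus_vβOf_pos hn1 hℓ1 _ _
  have hu : 1 ≤ u₀A κ Φ t p D g f := (units_eqA κ Φ t p D g f).2.2.2.2.1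
  have hr0 : ((fcellsA κ Φ t p D g f).r 0 : ℤ) = 40 * (Neg.Kq κ : ℤ) * u₀A κ Φ t p D g f := (units_eqA κ Φ t p D g f).2.2.1
  have hn : (1 : ℤ) ≤ (nL κ Φ t p D g f : ℤ) := by exact_mod_cast hn1
  have hk1 : k + 1 ≤ 1000 * Neg.Kq κ := by omega
  have hsl := slant_le κ Φ t p D g f mk hN hκ hℓ hk1 (mul_nonneg (by linarith : 0 ≤ u₀A κ Φ t p D g f) (by linarith : (0:ℤ) ≤ (nL κ Φ t p D g f : ℤ)))
  have hnA' : 2000 * (Neg.Kq κ : ℤ) * ((RA' κ Φ t p D mk : ℤ) + 2) ≤ (nL κ Φ t p D g f : ℤ) := by exact_mod_cast hnA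
  have hq' : 4 * (qB : ℤ) ≤ (nL κ Φ t p D g f : ℤ) := by exact_mod_cast hq
  have hKq : (1 : ℤ) ≤ (Neg.Kq κ : ℤ) := by exact_mod_cast Neg.one_le_Kq κ
  have hR0 : (0 : ℤ) ≤ (RA' κ Φ t p D mk : ℤ) := Nat.cast_nonneg _
  have hNr' : (Nr : ℤ) + 1 ≤ 1000 * (Neg.Kq κ : ℤ) := by exact_mod_cast hNr
  have hk' : (k : ℤ) ≤ Nr := by exact_mod_cast hk
  have hRn : RA' κ Φ t p D mk ≤ nL κ Φ t p D g f := by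
    have : RA' κ Φ t p D mk ≤ 2000 * Neg.Kq κ * (RA' κ Φ t p D mk + 2) := by
      have := Neg.one_le_Kq κ; nlinarith
    omega
  obtain ⟨-, hHi⟩ := xBoxA_bounds (qB := qB) hRn k
  clear hnA hq hk hk1 hℓ hκ hNr
  rw [hHi]
  rw [hr0] at hfar ⊢
  set n : ℤ := (nL κ Φ t p D g f : ℤ)
  set m := modulus (nL κ Φ t p D g f) (hL κ Φ t p D g f) (vL κ Φ t p D g f) (vβL κ Φ t p D g f)
  set u := u₀A κ Φ t p D g f
  set F := FcA κ Φ t p D g f yL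
  set R : ℤ := (RA' κ Φ t p D mk : ℤ)
  set Q : ℤ := (Neg.Kq κ : ℤ)
  set S := (shearUnit (nL κ Φ t p D g f) (hL κ Φ t p D g f) : ℤ) * (xBoxB (nL κ Φ t p D g f) (ℓL κ Φ t p D g f) (hL κ Φ t p D g f) (RA' κ Φ t p D mk) k + 1)
  have hnm : 0 < n * m := mul_pos (by linarith) hm0
  have hum : 0 ≤ u * m := mul_nonneg (by linarith) hm0.le
  have hkR : ((k : ℤ) + 1) * R ≤ 1000 * Q * R := mul_le_mul_of_nonneg_right (by linarith) hR0
  have p1 : n * m * (-F + u * ((k : ℤ) + 1)) ≤ n * m * (20 * (40 * Q * u) - lev + 2 * u) := by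
    refine mul_le_mul_of_nonneg_left ?_ hnm.le
    have : u * ((k : ℤ) + 1) ≤ u * ((Nr : ℤ) + 1) := mul_le_mul_of_nonneg_left (by linarith) (by linarith)
    linarith
  have p2 : u * m * (((k : ℤ) + 1) * R) ≤ u * m * (1000 * Q * R) := mul_le_mul_of_nonneg_left hkR hum
  have p3 : u * m * (4 * (qB : ℤ)) ≤ u * m * n := mul_le_mul_of_nonneg_left hq' hum
  have p4 : u * m * (2000 * Q * R) ≤ u * m * n := mul_le_mul_of_nonneg_left (by nlinarith) hum
  have p5 : n * m * (8 * u + 3) ≤ n * m * (5 * (40 * Q * u)) := by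
    refine mul_le_mul_of_nonneg_left ?_ hnm.le
    nlinarith
  have p7 : u * n * 1 ≤ u * n * m := mul_le_mul_of_nonneg_left (by linarith) (mul_nonneg (by linarith) (by linarith))
  have e : u * m * (((k : ℤ) + 1) * (n + R) + (qB : ℤ)) = n * m * (u * ((k : ℤ) + 1)) + u * m * (((k : ℤ) + 1) * R) + u * m * (qB : ℤ) := by ring
  nlinarith [p1, p2, p3, p4, p5, p7, hsl, hnm, hum, e]

end FloorsAX

end KS

end NegB

end PlanarSkeletonFrmFrom

end Summit.CriticalPhenomena.PercolationContinuityZ3.Theorems.Transplant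

end
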